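import Literature.Probability.Percolation.ArmSeparationExtSurgery
import Literature.Probability.Percolation.ArmSeparationInnerBound
import HarnessLib

/-!
# Corner guards for the external extremities

Topic: Probability / Percolation; family `crit-perc`. A brick of the discharge of
`Literature.Probability.Percolation.Nolin2008_twoArm_separation` (Nolin 2008, Thm. 11
[arXiv 0711.4948: Thm. 10]; `ArmSeparation.lean`). The surgery step of
`ArmSeparationExtSurgery.lean` fences both arms behind some sides of `∂Λ_{2M}` but lets the tips
approach the corners of the hexagon, where the corridors of the landing cannot start. As for the
internal extremities (`InGuard`, `ArmSeparationInner.lean`), **corner guards** — closed frames of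
the arm's colour at one of the scales `R₀ 32^i`, `i < K_g`, about each end of the side
(`(2M, -2M)` and `(2M, 0)`) — keep the tips `R₀` away from the corners
(`ext_tip_bounds_of_guards`), at the price of the failure probability `2 (1 - c_F²)^{K_g}` per
configuration:

* `outBad M T k₀ K R₀ Kg` (failure behind side `0`, or a missing guard), `OutGoodG` (none of the
  twelve rotated / colour-exchanged configurations is bad) and `OutTinyExtG M n k₀ K R₀` (both arms
  fenced with tips in the middle `[-2M + R₀, -R₀]` of their sides).
* `armEvent_subset_outTinyExtG_union`, `real_armEvent_le_out_stepG` — the step inequality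
  `P(A(n,2M)) ≤ P(OutTinyExtG) + P(¬ OutGoodG) · P(A(n, M))`, with
  `real_setOf_not_outGoodG_le` (`≤ 12 ((1-c₄)^{T+1} + T (1-c_F²)^K + 2 (1-c_F²)^{K_g})`) and the
  locality `determinedBy_setOf_not_outGoodG` (sites of norm `> M` when `R < M`, `2 R_g < M`).

## References

* P. Nolin, *Near-critical percolation in two dimensions*, Electron. J. Probab. 13 (2008), §4.4,
  proof of Thm. 11 [arXiv 0711.4948: Thm. 10, Lemma 14]. [Nolin2008]
* H. Kesten, *Scaling relations for 2D-percolation*, Comm. Math. Phys. 109 (1987), Lemma 2. [Kesten1987]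
-/

noncomputable section

open Set MeasureTheory

namespace Literature.Probability.Percolation

open LatticeModels

/-! ### The guarded events -/

/-- The lower end `(2M, -2M)` of side `0` of `∂Λ_{2M}`. [folklore] -/
def extC₁ (M : ℕ) : Site 2 := ![2 * (M : ℤ), -(2 * (M : ℤ))]

/-- The upper end `(2M, 0)` of side `0` of `∂Λ_{2M}`. [folklore] -/
def extC₂ (M : ℕ) : Site 2 := ![2 * (M : ℤ), 0]

/-- **The bad event of one configuration**: failure behind side `0`, or a missing corner guard. [cite: Nolin2008, §4.4 (arXiv 0711.4948: proof of Thm. 10)] -/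
def outBad (M T k₀ K R₀ Kg : ℕ) : Set (SiteConfig (Site 2)) :=
  {χ | OutFail M T k₀ K χ ∨ ¬ InGuard R₀ Kg (extC₁ M) χ ∨ ¬ InGuard R₀ Kg (extC₂ M) χ}

/-- **Nothing fails and all corners are guarded**, in the twelve rotated / colour-exchanged
configurations. [cite: Nolin2008, §4.4 (arXiv 0711.4948: proof of Thm. 10)] -/
def OutGoodG (M T k₀ K R₀ Kg : ℕ) (ω : SiteConfig (Site 2)) : Prop :=
  ∀ i < 6, rotConfig i ω ∉ outBad M T k₀ K R₀ Kg ∧ (rotConfig i ω)ᶜ ∉ outBad M T k₀ K R₀ Kg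

/-- A tip in the middle of the side: `-2M + R₀ ≤ z₁ ≤ -R₀`. [folklore] -/
def GoodTip (M R₀ : ℕ) (z : Site 2) : Prop := -(2 * (M : ℤ)) + R₀ ≤ z 1 ∧ z 1 ≤ -(R₀ : ℤ)

/-- **The guarded tiny extension exists**: both arms fenced (`OutTinyExt`) with tips in the middle
of their sides. [cite: Nolin2008, §4.4 (arXiv 0711.4948: proof of Thm. 10, first display)] -/
def OutTinyExtG (M n k₀ K R₀ : ℕ) : Set (SiteConfig (Site 2)) :=
  {ω | ∃ io < 6, ∃ ic < 6, ∃ Fo : TrapFencedArm M n k₀ K (rotConfig io ω), ∃ Fc : TrapFencedArm M n k₀ K (rotConfig ic ω)ᶜ,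
    GoodTip M R₀ Fo.z ∧ GoodTip M R₀ Fc.z}

/-! ### Guards keep the tips off the corners -/

/-- **Closed frames about the ends of the side force the tip into its middle**: if the closed
sites of `χ` contain frames at scales `R₁, R₂ ≥ 1` (`2 Rᵢ ≤ M`) about `(2M, -2M)` and `(2M, 0)`,
then the end `z ∈ trapO M` of a `χ`-open path from a site `a` of norm `≤ M` has
`-2M + R₁ ≤ z₁ ≤ -R₂`. [cite: Nolin2008, §4.4 Thm. 11 (proof) (arXiv 0711.4948: Thm. 10)] -/
theorem ext_tip_bounds_of_guards {M R₁ R₂ : ℕ} (h₁ : 1 ≤ R₁) (h₁M : 2 * R₁ ≤ M) (h₂ : 1 ≤ R₂) (h₂M : 2 * R₂ ≤ M)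
    {χ : SiteConfig (Site 2)} (hdn : χᶜ ∈ triFrameAt (extC₁ M) R₁) (hup : χᶜ ∈ triFrameAt (extC₂ M) R₂)
    {A : Set (Site 2)} {a z : Site 2} (ha : triNorm a ≤ M) (hz : z ∈ trapO M)
    (hp : PathIn triGraph (A ∩ χ) a z) : -(2 * (M : ℤ)) + R₁ ≤ z 1 ∧ z 1 ≤ -(R₂ : ℤ) := by
  obtain ⟨hz0, hz1, hz1'⟩ := trapO_coord hz
  have ha0 : a 0 ≤ M := (triNorm_le_iff_lin.1 ha).1
  constructor
  · by_contra hlt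
    rw [not_le] at hlt
    obtain ⟨F⟩ := nonempty_frameData hdn
    obtain ⟨v, hvA, hvK⟩ := F.exists_mem_K h₁ (s := z) (t := a)
      (by simp only [extC₁, Matrix.cons_val_zero, Matrix.cons_val_one, Matrix.cons_val_fin_one]; omega)
      (by simp only [extC₁, Matrix.cons_val_zero, Matrix.cons_val_one, Matrix.cons_val_fin_one]; omega) hp.symm
    exact F.K_subset hvK hvA.2
  · by_contra hlt
    rw [not_le] at hlt
    obtain ⟨F⟩ := nonempty_frameData hup
    obtain ⟨v, hvA, hvK⟩ := F.exists_mem_K h₂ (s := z) (t := a)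
      (by simp only [extC₂, Matrix.cons_val_zero, Matrix.cons_val_one, Matrix.cons_val_fin_one]; omega)
      (by simp only [extC₂, Matrix.cons_val_zero, Matrix.cons_val_one, Matrix.cons_val_fin_one]; omega) hp.symm
    exact F.K_subset hvK hvA.2

/-- **The deterministic step with guards**: `A(n, 2M) ⊆ OutTinyExtG ∪ ({¬ OutGoodG} ∩ A(n, M))`
(`n ≤ M`, `R₀ ≥ 1`, `2 R₀ 32^i ≤ M` for `i < K_g`). [cite: Nolin2008, §4.4 (arXiv 0711.4948: proof of Thm. 10, first display)] -/
theorem armEvent_subset_outTinyExtG_union {M n R₀ Kg : ℕ} (hM : 1 ≤ M) (hnM : n ≤ M) (hR₀ : 1 ≤ R₀)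
    (hRg : ∀ i < Kg, 2 * trapScale R₀ i ≤ M) (T k₀ K : ℕ) :
    armEvent ![true, false] n (2 * M) ⊆
      OutTinyExtG M n k₀ K R₀ ∪ ({ω | ¬ OutGoodG M T k₀ K R₀ Kg ω} ∩ armEvent ![true, false] n M) := by
  intro ω hω
  by_cases hg : OutGoodG M T k₀ K R₀ Kg ω
  · left
    have hgood : OutGood M T k₀ K ω := fun i hi => by
      obtain ⟨h1, h2⟩ := hg i hi
      simp only [outBad, Set.mem_setOf_eq, not_or] at h1 h2
      exact ⟨h1.1, h2.1⟩
    obtain ⟨io, hio, ic, hic, ⟨Fo⟩, ⟨Fc⟩⟩ := exists_two_trapFencedArm hM hnM hgood hω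
    have tip : ∀ {χ : SiteConfig (Site 2)} (F : TrapFencedArm M n k₀ K χ),
        InGuard R₀ Kg (extC₁ M) χ → InGuard R₀ Kg (extC₂ M) χ → GoodTip M R₀ F.z := by
      intro χ F ⟨i₁, hi₁, hg₁⟩ ⟨i₂, hi₂, hg₂⟩
      have hR₁ := le_trapScale R₀ i₁
      have hR₂ := le_trapScale R₀ i₂
      have hn : triNorm F.a ≤ M := by rw [F.norm_a]; exact_mod_cast hnM
      obtain ⟨hlo, hhi⟩ := ext_tip_bounds_of_guards (by omega) (hRg i₁ hi₁) (by omega) (hRg i₂ hi₂) hg₁.1 hg₂.1 hn F.z_mem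
        F.path_tip
      have hR₁' : (R₀ : ℤ) ≤ trapScale R₀ i₁ := by exact_mod_cast hR₁
      have hR₂' : (R₀ : ℤ) ≤ trapScale R₀ i₂ := by exact_mod_cast hR₂
      exact ⟨by omega, by omega⟩
    obtain ⟨ho1, ho2⟩ := hg io hio
    obtain ⟨hc1, hc2⟩ := hg ic hic
    simp only [outBad, Set.mem_setOf_eq, not_or, not_not] at ho1 hc2
    exact ⟨io, hio, ic, hic, Fo, Fc, tip Fo ho1.2.1 ho1.2.2, tip Fc hc2.2.1 hc2.2.2⟩
  · exact Or.inr ⟨hg, armEvent_mono_holds _ hnM (by omega) hω⟩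

/-! ### Probability of the bad event -/

/-- `P(outBad) ≤ (1 - c₄)^{T+1} + T (1 - c_F²)^K + 2 (1 - c_F²)^{K_g}`. [cite: Nolin2008, §4.4 Lemma 15 (proof) (arXiv 0711.4948: Lemma 14, (4.20))] -/
theorem real_outBad_le {cF c₄ : ℝ} (hcF : 0 < cF)
    (hF : ∀ (z : Site 2) (k : ℕ), 1 ≤ k → cF ≤ (triSitePercolation half).real (triFrameAt z k))
    (hrsw : ∀ n : ℕ, 1 ≤ ⌊(4 : ℝ) * n⌋₊ → c₄ ≤ triLRCrossingProb half ⌊(4 : ℝ) * n⌋₊ n)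
    {M T k₀ K R₀ Kg : ℕ} (hM : 3 ≤ M) (hk₀ : 1 ≤ k₀) (hR₀ : 1 ≤ R₀) (hKM : ∀ j < K, 16 * (trapScale k₀ j : ℤ) + 1 ≤ M) :
    (triSitePercolation half).real (outBad M T k₀ K R₀ Kg) ≤
      (1 - c₄) ^ (T + 1) + T * (1 - cF ^ 2) ^ K + 2 * (1 - cF ^ 2) ^ Kg := by
  have h1 := real_setOf_outFail_le hcF hF hrsw hM hk₀ hKM (T := T)
  have h2 := real_not_inGuard_le hcF hF hR₀ Kg (extC₁ M)
  have h3 := real_not_inGuard_le hcF hF hR₀ Kg (extC₂ M)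
  have hset : outBad M T k₀ K R₀ Kg = {χ | OutFail M T k₀ K χ} ∪
      ({χ | ¬ InGuard R₀ Kg (extC₁ M) χ} ∪ {χ | ¬ InGuard R₀ Kg (extC₂ M) χ}) := by
    ext χ; simp only [outBad, Set.mem_setOf_eq, Set.mem_union]
  rw [hset]
  refine (measureReal_union_le _ _).trans ?_
  refine (add_le_add le_rfl (measureReal_union_le _ _)).trans ?_
  linarith

/-- The bad event in a rotated frame has the same probability. [folklore] -/
theorem real_preimage_rotConfig_outBad (M T k₀ K R₀ Kg i : ℕ) :
    (triSitePercolation half).real {ω | rotConfig i ω ∈ outBad M T k₀ K R₀ Kg} =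
      (triSitePercolation half).real (outBad M T k₀ K R₀ Kg) :=
  real_preimage_rotConfig half i _

/-- The bad event of the complementary colour in a rotated frame has the same probability (`p = 1/2`). [folklore] -/
theorem real_preimage_rotConfig_compl_outBad (M T k₀ K R₀ Kg i : ℕ) :
    (triSitePercolation half).real {ω | (rotConfig i ω)ᶜ ∈ outBad M T k₀ K R₀ Kg} =
      (triSitePercolation half).real (outBad M T k₀ K R₀ Kg) := by
  have hset : {ω : SiteConfig (Site 2) | (rotConfig i ω)ᶜ ∈ outBad M T k₀ K R₀ Kg} =
      compl ⁻¹' (rotConfig i ⁻¹' outBad M T k₀ K R₀ Kg) := by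
    ext ω
    simp only [Set.mem_setOf_eq, Set.mem_preimage, rotConfig_compl]
  rw [hset]
  unfold triSitePercolation
  rw [sitePercolation_real_preimage_compl, symm_half]
  exact real_preimage_rotConfig half i _

/-- **`P(¬ OutGoodG) ≤ 12 ((1 - c₄)^{T+1} + T (1 - c_F²)^K + 2 (1 - c_F²)^{K_g})`**: union bound over
the six frames and the two colours. [cite: Nolin2008, §4.4 (arXiv 0711.4948: proof of Thm. 10, first step, "(4δ)")] -/
theorem real_setOf_not_outGoodG_le {cF c₄ : ℝ} (hcF : 0 < cF)
    (hF : ∀ (z : Site 2) (k : ℕ), 1 ≤ k → cF ≤ (triSitePercolation half).real (triFrameAt z k))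
    (hrsw : ∀ n : ℕ, 1 ≤ ⌊(4 : ℝ) * n⌋₊ → c₄ ≤ triLRCrossingProb half ⌊(4 : ℝ) * n⌋₊ n)
    {M T k₀ K R₀ Kg : ℕ} (hM : 3 ≤ M) (hk₀ : 1 ≤ k₀) (hR₀ : 1 ≤ R₀) (hKM : ∀ j < K, 16 * (trapScale k₀ j : ℤ) + 1 ≤ M) :
    (triSitePercolation half).real {ω | ¬ OutGoodG M T k₀ K R₀ Kg ω} ≤
      12 * ((1 - c₄) ^ (T + 1) + T * (1 - cF ^ 2) ^ K + 2 * (1 - cF ^ 2) ^ Kg) := by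
  set μ := triSitePercolation half with hμ
  set B := outBad M T k₀ K R₀ Kg with hB
  have hbad := real_outBad_le hcF hF hrsw hM hk₀ hR₀ hKM (T := T) (Kg := Kg)
  have hsub : {ω | ¬ OutGoodG M T k₀ K R₀ Kg ω} ⊆ ⋃ i ∈ Finset.range 6,
      ({ω | rotConfig i ω ∈ B} ∪ {ω | (rotConfig i ω)ᶜ ∈ B}) := by
    intro ω hω
    simp only [OutGoodG, Set.mem_setOf_eq, not_forall, not_and_or, not_not, exists_prop] at hω
    obtain ⟨i, hi, h⟩ := hω
    simp only [Set.mem_iUnion, Set.mem_union, Set.mem_setOf_eq]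
    exact ⟨i, Finset.mem_range.2 hi, h⟩
  calc μ.real {ω | ¬ OutGoodG M T k₀ K R₀ Kg ω}
      ≤ μ.real (⋃ i ∈ Finset.range 6, ({ω | rotConfig i ω ∈ B} ∪ {ω | (rotConfig i ω)ᶜ ∈ B})) :=
        measureReal_mono hsub (measure_ne_top _ _)
    _ ≤ ∑ i ∈ Finset.range 6, μ.real ({ω | rotConfig i ω ∈ B} ∪ {ω | (rotConfig i ω)ᶜ ∈ B}) :=
        measureReal_biUnion_finset_le _ _
    _ ≤ ∑ i ∈ Finset.range 6, 2 * μ.real B := by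
        refine Finset.sum_le_sum fun i _ => ?_
        refine (measureReal_union_le _ _).trans ?_
        rw [hμ, hB, real_preimage_rotConfig_outBad, real_preimage_rotConfig_compl_outBad]
        linarith
    _ = 12 * μ.real B := by rw [Finset.sum_const, Finset.card_range, nsmul_eq_mul]; ring
    _ ≤ _ := mul_le_mul_of_nonneg_left hbad (by norm_num)

/-- The union of two events determined by `K` is determined by `K`. [folklore] -/
theorem DeterminedBy.union {V : Type*} {A B : Set (Set V)} {K : Set V} (hA : DeterminedBy A K) (hB : DeterminedBy B K) :
    DeterminedBy (A ∪ B) K := by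
  have h := (hA.compl.inter hB.compl).compl
  rwa [← Set.compl_union, compl_compl] at h

/-! ### Locality: the guarded failure event lives outside `Λ_M` -/

/-- The sites read by `outBad` behind side `0`: those of `OutFail` and the two squares of
half-width `R_g` about the ends of the side. [folklore] -/
def outBadFinset (M R Rg : ℕ) : Finset (Site 2) :=
  outFailFinset M R ∪ (triSquareFinset (extC₁ M) Rg ∪ triSquareFinset (extC₂ M) Rg)

/-- All sites read by `outBad` have first coordinate `> M` (`R < M`, `Rg < M`). [folklore] -/
theorem lt_apply_zero_of_mem_outBadFinset {M R Rg : ℕ} (hRM : R < M) (hRg : Rg < M) {v : Site 2}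
    (hv : v ∈ outBadFinset M R Rg) : (M : ℤ) < v 0 := by
  rw [outBadFinset, Finset.mem_union, Finset.mem_union] at hv
  rcases hv with hv | hv | hv
  · exact lt_apply_zero_of_mem_outFailFinset hRM hv
  · rw [mem_triSquareFinset] at hv
    simp only [extC₁, Matrix.cons_val_zero] at hv
    omega
  · rw [mem_triSquareFinset] at hv
    simp only [extC₂, Matrix.cons_val_zero] at hv
    omega

/-- A guard about `C` is determined by the square of half-width `R_g` about `C`
(`16 · R₀ 32^i ≤ R_g` for `i < K_g`). [folklore] -/
theorem determinedBy_setOf_inGuard {R₀ Kg Rg : ℕ} (hRg : ∀ i < Kg, 16 * trapScale R₀ i ≤ Rg) (C : Site 2) :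
    DeterminedBy {χ : SiteConfig (Site 2) | InGuard R₀ Kg C χ} ↑(triSquareFinset C Rg) := by
  have hset : {χ : SiteConfig (Site 2) | InGuard R₀ Kg C χ} =
      ⋃ i : Fin Kg, {χ | χᶜ ∈ trapRSW C (trapScale R₀ i)} := by
    ext χ
    simp only [InGuard, Set.mem_setOf_eq, Set.mem_iUnion]
    constructor
    · rintro ⟨i, hi, h⟩; exact ⟨⟨i, hi⟩, h⟩
    · rintro ⟨⟨i, hi⟩, h⟩; exact ⟨i, hi, h⟩
  rw [hset]
  refine DeterminedBy.iUnion fun i => ?_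
  refine (determinedBy_compl_mem (determinedBy_trapRSW C (trapScale R₀ i))).mono ?_
  intro v hv
  rw [Finset.mem_coe, mem_triSqAnnulusFinset] at hv
  rw [Finset.mem_coe, mem_triSquareFinset]
  have := hRg i i.2
  have h16 : (16 * (trapScale R₀ i : ℤ)) ≤ Rg := by exact_mod_cast this
  omega

/-- `outBad` is determined by `outBadFinset M R R_g`. [folklore] -/
theorem determinedBy_outBad {M T k₀ K R₀ Kg R Rg : ℕ} (hM : 1 ≤ M) (hR : ∀ j < K, 2 * trapScale k₀ j + 1 ≤ R)
    (hRg : ∀ i < Kg, 16 * trapScale R₀ i ≤ Rg) :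
    DeterminedBy (outBad M T k₀ K R₀ Kg) ↑(outBadFinset M R Rg) := by
  have hset : outBad M T k₀ K R₀ Kg = {χ | OutFail M T k₀ K χ} ∪
      (({χ | InGuard R₀ Kg (extC₁ M) χ})ᶜ ∪ ({χ | InGuard R₀ Kg (extC₂ M) χ})ᶜ) := by
    ext χ; simp only [outBad, Set.mem_setOf_eq, Set.mem_union, Set.mem_compl_iff]
  rw [hset]
  have s1 : (↑(outFailFinset M R) : Set (Site 2)) ⊆ ↑(outBadFinset M R Rg) :=
    Finset.coe_subset.2 Finset.subset_union_left
  have s2 : (↑(triSquareFinset (extC₁ M) Rg) : Set (Site 2)) ⊆ ↑(outBadFinset M R Rg) :=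
    Finset.coe_subset.2 (Finset.subset_union_left.trans Finset.subset_union_right)
  have s3 : (↑(triSquareFinset (extC₂ M) Rg) : Set (Site 2)) ⊆ ↑(outBadFinset M R Rg) :=
    Finset.coe_subset.2 (Finset.subset_union_right.trans Finset.subset_union_right)
  exact ((determinedBy_setOf_outFail hM hR).mono s1).union
    ((((determinedBy_setOf_inGuard hRg _).mono s2).compl).union (((determinedBy_setOf_inGuard hRg _).mono s3).compl))

/-- The sites read by `OutGoodG`: the six rotated copies of `outBadFinset`. [folklore] -/
def outGoodGFinset (M R Rg : ℕ) : Finset (Site 2) :=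
  (Finset.range 6).biUnion fun i => (outBadFinset M R Rg).image (triRotIsoPow i)

/-- All sites read by `OutGoodG` have norm `> M` (`R < M`, `R_g < M`). [cite: Nolin2008, §4.4 (arXiv 0711.4948: proof of Thm. 10, "by independence")] -/
theorem lt_triNorm_of_mem_outGoodGFinset {M R Rg : ℕ} (hRM : R < M) (hRg : Rg < M) {v : Site 2}
    (hv : v ∈ outGoodGFinset M R Rg) : (M : ℤ) < triNorm v := by
  rw [outGoodGFinset, Finset.mem_biUnion] at hv
  obtain ⟨i, -, hv⟩ := hv
  rw [Finset.mem_image] at hv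
  obtain ⟨w, hw, rfl⟩ := hv
  rw [triNorm_rot]
  exact lt_triNorm_of_lt_apply_zero (lt_apply_zero_of_mem_outBadFinset hRM hRg hw)

/-- `outGoodGFinset` is disjoint from the ball `Λ_M`. [folklore] -/
theorem disjoint_outGoodGFinset_triBall {M R Rg : ℕ} (hRM : R < M) (hRg : Rg < M) :
    Disjoint (outGoodGFinset M R Rg) (triBall M) := by
  rw [Finset.disjoint_left]
  intro v hv hvB
  have h1 := lt_triNorm_of_mem_outGoodGFinset hRM hRg hv
  have h2 := mem_triBall_iff.1 hvB
  omega

/-- **`OutGoodG` is determined by `outGoodGFinset M R R_g`.** [cite: Nolin2008, §4.4 (arXiv 0711.4948: proof of Thm. 10, "by independence")] -/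
theorem determinedBy_setOf_not_outGoodG {M T k₀ K R₀ Kg R Rg : ℕ} (hM : 1 ≤ M) (hR : ∀ j < K, 2 * trapScale k₀ j + 1 ≤ R)
    (hRg : ∀ i < Kg, 16 * trapScale R₀ i ≤ Rg) :
    DeterminedBy {ω : SiteConfig (Site 2) | ¬ OutGoodG M T k₀ K R₀ Kg ω} ↑(outGoodGFinset M R Rg) := by
  have hB := determinedBy_outBad (T := T) hM hR hRg
  have hsub : ∀ i < 6, triRotIsoPow i '' (↑(outBadFinset M R Rg) : Set (Site 2)) ⊆ ↑(outGoodGFinset M R Rg) := by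
    intro i hi v hv
    obtain ⟨w, hw, rfl⟩ := hv
    rw [Finset.mem_coe, outGoodGFinset, Finset.mem_biUnion]
    exact ⟨i, Finset.mem_range.2 hi, Finset.mem_image.2 ⟨w, hw, rfl⟩⟩
  have d1 : ∀ i < 6, DeterminedBy {ω : SiteConfig (Site 2) | rotConfig i ω ∈ outBad M T k₀ K R₀ Kg} ↑(outGoodGFinset M R Rg) :=
    fun i hi => (determinedBy_preimage_rotConfig i hB).mono (hsub i hi)
  have d2 : ∀ i < 6, DeterminedBy {ω : SiteConfig (Site 2) | (rotConfig i ω)ᶜ ∈ outBad M T k₀ K R₀ Kg} ↑(outGoodGFinset M R Rg) := by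
    intro i hi
    have hset : {ω : SiteConfig (Site 2) | (rotConfig i ω)ᶜ ∈ outBad M T k₀ K R₀ Kg} =
        rotConfig i ⁻¹' {χ : Set (Site 2) | χᶜ ∈ outBad M T k₀ K R₀ Kg} := by
      ext ω; simp only [Set.mem_setOf_eq, Set.mem_preimage]
    rw [hset]
    exact (determinedBy_preimage_rotConfig i (determinedBy_compl_mem hB)).mono (hsub i hi)
  have hset : {ω : SiteConfig (Site 2) | ¬ OutGoodG M T k₀ K R₀ Kg ω} =
      ⋃ i : Fin 6, ({ω | rotConfig i ω ∈ outBad M T k₀ K R₀ Kg} ∪ {ω | (rotConfig i ω)ᶜ ∈ outBad M T k₀ K R₀ Kg}) := by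
    ext ω
    simp only [OutGoodG, Set.mem_setOf_eq, not_forall, not_and_or, not_not, Set.mem_iUnion, Set.mem_union, exists_prop]
    constructor
    · rintro ⟨i, hi, h⟩; exact ⟨⟨i, hi⟩, h⟩
    · rintro ⟨⟨i, hi⟩, h⟩; exact ⟨i, hi, h⟩
  rw [hset]
  exact DeterminedBy.iUnion fun i => (d1 i i.2).union (d2 i i.2)

/-- **Independence of the guarded failure event from the events of `Λ_M`** (`R < M`, `R_g < M`). [cite: Nolin2008, §4.4 (arXiv 0711.4948: proof of Thm. 10, "by independence")] -/
theorem real_inter_setOf_not_outGoodG {M T k₀ K R₀ Kg R Rg : ℕ} (hM : 1 ≤ M) (hR : ∀ j < K, 2 * trapScale k₀ j + 1 ≤ R)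
    (hRg : ∀ i < Kg, 16 * trapScale R₀ i ≤ Rg) (hRM : R < M) (hRgM : Rg < M)
    {A : Set (SiteConfig (Site 2))} (hA : DeterminedBy A ↑(triBall M)) :
    (triSitePercolation half).real (A ∩ {ω | ¬ OutGoodG M T k₀ K R₀ Kg ω}) =
      (triSitePercolation half).real A * (triSitePercolation half).real {ω | ¬ OutGoodG M T k₀ K R₀ Kg ω} := by
  unfold triSitePercolation
  exact sitePercolation_real_inter_of_disjoint half hA (determinedBy_setOf_not_outGoodG hM hR hRg)
    (disjoint_outGoodGFinset_triBall hRM hRgM).symm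

/-- **The guarded step inequality for the outer extremities**:
`P(A(n, 2M)) ≤ P(OutTinyExtG M n k₀ K R₀) + P(¬ OutGoodG M T k₀ K R₀ K_g) · P(A(n, M))`
(`n ≤ M`, `2 k_j + 2 ≤ M`, `R₀ ≥ 1`, `16 · R₀ 32^i < M`). [cite: Nolin2008, §4.4 (arXiv 0711.4948: proof of Thm. 10, first display); Kesten1987, Lemma 2] -/
theorem real_armEvent_le_out_stepG {M n T k₀ K R₀ Kg : ℕ} (hM : 2 ≤ M) (hnM : n ≤ M) (hR₀ : 1 ≤ R₀)
    (hKM : ∀ j < K, 2 * trapScale k₀ j + 2 ≤ M) (hRg : ∀ i < Kg, 16 * trapScale R₀ i < M) :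
    (triSitePercolation half).real (armEvent ![true, false] n (2 * M)) ≤
      (triSitePercolation half).real (OutTinyExtG M n k₀ K R₀) +
        (triSitePercolation half).real {ω | ¬ OutGoodG M T k₀ K R₀ Kg ω} *
          (triSitePercolation half).real (armEvent ![true, false] n M) := by
  have hsub := armEvent_subset_outTinyExtG_union (Kg := Kg) (le_trans (by norm_num) hM) hnM hR₀
    (fun i hi => by have := hRg i hi; omega) T k₀ K
  have hA : DeterminedBy (armEvent ![true, false] n M) ↑(triBall M) :=
    (determinedBy_armEvent _ hnM).mono (Finset.coe_subset.2 (Finset.filter_subset _ _))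
  have hind := real_inter_setOf_not_outGoodG (T := T) (k₀ := k₀) (K := K) (R₀ := R₀) (Kg := Kg) (R := M - 1) (Rg := M - 1)
    (le_trans (by norm_num) hM) (fun j hj => by have := hKM j hj; omega) (fun i hi => by have := hRg i hi; omega)
    (by omega) (by omega) hA
  calc (triSitePercolation half).real (armEvent ![true, false] n (2 * M))
      ≤ (triSitePercolation half).real (OutTinyExtG M n k₀ K R₀ ∪
          ({ω | ¬ OutGoodG M T k₀ K R₀ Kg ω} ∩ armEvent ![true, false] n M)) :=
        measureReal_mono hsub (measure_ne_top _ _)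
    _ ≤ (triSitePercolation half).real (OutTinyExtG M n k₀ K R₀) +
          (triSitePercolation half).real ({ω | ¬ OutGoodG M T k₀ K R₀ Kg ω} ∩ armEvent ![true, false] n M) :=
        measureReal_union_le _ _
    _ = _ := by rw [Set.inter_comm, hind, mul_comm]

end Literature.Probability.Percolation
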